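import Summits.Ventures.CertifiedManyBodySolver.Observables.StiffnessTLKineticCeiling
import Literature.MathematicalPhysics.QuantumLattice.HubbardNNNHoppingFluxStiffnessSecondOrder
import Literature.MathematicalPhysics.QuantumLattice.FreeFermiGasNoPairFieldLRO
import HarnessLib

/-!
# Ventures/CertifiedManyBodySolver — Observables: the ODD-MOMENT (Krylov) stiffness ceiling in the
# thermodynamic limit — a generic "finite-volume ceiling + torus limit ⇒ certified row" adapter and its
# instance for the row `R-K3-TL` (cell hubbard-obs, `HOME/hubbard-obs-p2/ops/tl/README.md`)

HONEST FRAMING: one-sided CEILINGS on the flux stiffness (helicity modulus / superfluid weight); not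
a superconductivity verdict; no stiffness floor follows from equal-time data and an energy window.

Companion of `StiffnessTLKineticCeiling.lean` (the f-sum row adapter
`fluxStiffness_le_of_torusLimit_kineticDensity_ge`). The f-sum ceiling `ρ_s ≤ ½k_x` is blind to Kohn's
paramagnetic term; the finite-volume odd-moment ceiling of
`Literature/…/HubbardNNNHoppingFluxStiffnessCommutator.lean` sharpens it with the first Krylov direction
`η = [H,𝒥]ψ`: for every real `λ`, `ρ_s L² ≤ ½Re⟨ψ,𝒦ψ⟩ + 2λ m₁(ψ) + λ² m₃(ψ)` with
`m₁ = Re⟨𝒥ψ,(H−E₀)𝒥ψ⟩` and `m₃ = Re⟨Bψ,(H−E₀)Bψ⟩`, `B = H𝒥 − 𝒥H` (`fluxStiffness_mul_sq_le_kinetic_add_oddMoments`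
below, `t' = 0` spelling). Both moments are expectations of translation sums of LOCAL fermion polynomials,
so the right-hand side divided by `L²` is, for each fixed `λ`, a linear functional of finitely many local
expectations per site — an objective of the programme's thermodynamic-limit window relaxations.

* `fluxStiffness_le_of_torusLimit_functional_row` — **generic adapter**: if a per-side functional `Φ_L`
  bounds `ρ_s ≤ Φ_L(ψ)` for every unit sector ground state at every large even side, converges along
  every torus-limit ground-state sequence to a functional `Φ∞(ω)` of the limit state, and a certificate
  gives `Φ∞(ω) ≤ q` on that class, then `ρ_s ≤ q` (ground states exist at every side, even sides have
  torus-limit points by weak-⋆ compactness, `ge_of_tendsto`). The kinetic adapter of the companion file is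
  the instance `Φ_L(ψ) = −Re⟨ψ,H_L(1,0)ψ⟩/(4L²)`.
* `fluxStiffness_le_of_torusLimit_oddMoment_row` — **the `R-K3-TL` adapter**: with
  `Φ_L(ψ) = (½Re⟨ψ,𝒦ψ⟩ + 2λ m₁(ψ) + λ² m₃(ψ))/L²` the finite-volume hypothesis is DISCHARGED by the
  odd-moment ceiling; what remains is (i) the IDENTIFICATION/CONVERGENCE hypothesis — along torus-limit
  ground-state sequences the three per-site quantities converge to given functionals `k̄(ω)`, `m̄₁(ω)`,
  `m̄₃(ω)` of the limit state (for the cell's word densities `kx`, `U·d1U`, `U²·m3T + U³·m3U` this is the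
  expansion of the commutators into translation sums of local words plus weak-⋆ convergence; checked
  symbolically and numerically by the cell, NOT in the kernel — hence an explicit hypothesis here) — and
  (ii) the certificate `½k̄(ω) + 2λ m̄₁(ω) + λ² m̄₃(ω) ≤ q` on the torus-limit ground-state class. Then
  `ρ_s ≤ q` (tree units; `D_s^{HVR} = ρ_s/2`, `D^{SWZ}/(πe²) = 2ρ_s`).

References: [Kohn1964]; [ScalapinoWhiteZhang1993] §II; [Lipparini2008] eqs. (8.30), (8.39);
[BohigasLaneMartorell1979]; [BratteliRobinsonI1987] §4.3.1 (torus limits).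
-/

noncomputable section

namespace Summit.Ventures.CertifiedManyBodySolver.Observables

open Matrix Finset Filter Topology
open Literature.MathematicalPhysics.QuantumLattice
open Literature.MathematicalPhysics.QuantumLattice.ThermodynamicLimit
open Literature.MathematicalPhysics.QuantumFieldTheory
open Literature.Probability.LatticeModels
open scoped ComplexOrder ComplexConjugate Topology

/-! ### Finite volume: the fixed-`λ` odd-moment ceiling, `t' = 0` spelling -/

section Finite

variable {L : ℕ} [NeZero L]

/-- **Fixed-`λ` odd-moment (Krylov) stiffness ceiling, square Hubbard torus** (`L ≥ 3`, `t = 1`,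
`t' = 0`): if `ρ_s θ² ≤ E_L(θ) − E_L(0)` for `|θ| ≤ θ₀` (`θ₀ > 0`), then every zero-flux `(N_L, 0)`-sector
ground state `ψ` (unit vector) of `hubbardTorus 2 L 1 U` satisfies, for every real `λ`,
`ρ_s L² ≤ ½Re⟨ψ,𝒦ψ⟩ + 2λ m₁(ψ) + λ² m₃(ψ)` with `𝒦 = kinOpTT' L 0`, `𝒥 = curOpTT' L 0`,
`m₁ = Re⟨𝒥ψ, H𝒥ψ⟩ − E₀‖𝒥ψ‖²`, `B = H𝒥 − 𝒥H`, `m₃ = Re⟨Bψ, HBψ⟩ − E₀‖Bψ‖²`, `E₀ = E_L(0)` — the direction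
`η = Bψ` in the second-order Rayleigh inequality (`stiffnessTT'_mul_sq_le_of_isGroundStateInSector`;
`Re⟨ψ, 𝒥(Bψ)⟩ = m₁`); the optimal and certified forms are the Literature file
`HubbardNNNHoppingFluxStiffnessCommutator.lean` (`stiffnessTT'_mul_sq_le_kinetic_sub_firstMoment_sq_div_thirdMoment`,
`stiffnessTT'_mul_sq_le_of_certified_odd_moments`). [cite: Lipparini2008, eq. (8.30)] -/
theorem fluxStiffness_mul_sq_le_kinetic_add_oddMoments (hL : 3 ≤ L) {U δ ρs θ₀ : ℝ} (hθ₀ : 0 < θ₀)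
    (hst : ∀ θ : ℝ, |θ| ≤ θ₀ → ρs * θ ^ 2 ≤ fluxEnergy L U δ θ - fluxEnergy L U δ 0)
    {ψ : Fock (Orb (FermionTorus 2 L))}
    (hgs : IsGroundStateInSector (hubbardTorus 2 L 1 U) (2 * ⌊(1 - δ) * (L : ℝ) ^ 2 / 2⌋₊) 0 ψ)
    (h1 : star ψ ⬝ᵥ ψ = 1) (lam : ℝ) :
    ρs * (L : ℝ) ^ 2 ≤
      (star ψ ⬝ᵥ (kinOpTT' L 0 *ᵥ ψ)).re / 2 +
        2 * lam * ((star (curOpTT' L 0 *ᵥ ψ) ⬝ᵥ (hubbardTorus 2 L 1 U *ᵥ (curOpTT' L 0 *ᵥ ψ))).re -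
          fluxEnergy L U δ 0 * (star (curOpTT' L 0 *ᵥ ψ) ⬝ᵥ (curOpTT' L 0 *ᵥ ψ)).re) +
        lam ^ 2 * ((star ((hubbardTorus 2 L 1 U * curOpTT' L 0 - curOpTT' L 0 * hubbardTorus 2 L 1 U) *ᵥ ψ) ⬝ᵥ
            (hubbardTorus 2 L 1 U *ᵥ
              ((hubbardTorus 2 L 1 U * curOpTT' L 0 - curOpTT' L 0 * hubbardTorus 2 L 1 U) *ᵥ ψ))).re -
          fluxEnergy L U δ 0 *
            (star ((hubbardTorus 2 L 1 U * curOpTT' L 0 - curOpTT' L 0 * hubbardTorus 2 L 1 U) *ᵥ ψ) ⬝ᵥ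
              ((hubbardTorus 2 L 1 U * curOpTT' L 0 - curOpTT' L 0 * hubbardTorus 2 L 1 U) *ᵥ ψ)).re) := by
  -- move to the `t–t'` spelling at `t' = 0`
  have hst' : ∀ θ : ℝ, |θ| ≤ θ₀ →
      ρs * θ ^ 2 ≤ fluxEnergyTT' L 0 U δ θ - fluxEnergyTT' L 0 U δ 0 := by
    simpa only [fluxEnergyTT'_tPrime_zero] using hst
  have hgs' : IsGroundStateInSector (hubbardTorusTT' L 1 0 U) (2 * ⌊(1 - δ) * (L : ℝ) ^ 2 / 2⌋₊) 0 ψ := by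
    rw [hubbardTorusTT'_zero]; exact hgs
  have hHmem : ∀ v ∈ szSector (2 * ⌊(1 - δ) * (L : ℝ) ^ 2 / 2⌋₊) (0 : ℝ),
      hubbardTorusTT' L 1 0 U *ᵥ v ∈ szSector (2 * ⌊(1 - δ) * (L : ℝ) ^ 2 / 2⌋₊) (0 : ℝ) :=
    fun v hv => mulVec_mem_szSector_of_commute (hubbardTorusTT'_commute_totalNumber L 1 0 U)
      (hubbardTorusTT'_commute_spinZ L 1 0 U) hv
  have hη : (hubbardTorusTT' L 1 0 U * curOpTT' L 0 - curOpTT' L 0 * hubbardTorusTT' L 1 0 U) *ᵥ ψ ∈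
      szSector (2 * ⌊(1 - δ) * (L : ℝ) ^ 2 / 2⌋₊) 0 := by
    rw [sub_mulVec, ← mulVec_mulVec, ← mulVec_mulVec]
    exact Submodule.sub_mem _ (hHmem _ (curOpTT'_mulVec_mem_szSector 0 hgs'.1))
      (curOpTT'_mulVec_mem_szSector 0 (hHmem _ hgs'.1))
  have h := stiffnessTT'_mul_sq_le_of_isGroundStateInSector hL 0 U δ hθ₀ hst' hgs' h1 hη lam
  have hE : hubbardTorusTT' L 1 0 U *ᵥ ψ = ((fluxEnergyTT' L 0 U δ 0 : ℝ) : ℂ) • ψ := by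
    rw [fluxEnergyTT'_eq, hubbardTorusTT'Flux_zero]
    exact hgs'.2.2
  -- `Re⟨ψ, 𝒥(Bψ)⟩ = m₁` (`B = H𝒥 − 𝒥H`, `Hψ = E₀ψ`, `𝒥` Hermitian)
  set H := hubbardTorusTT' L 1 0 U with hHdef
  set J := curOpTT' L 0 with hJdef
  have hJv : ∀ v : Fock (Orb (FermionTorus 2 L)), star ψ ⬝ᵥ (J *ᵥ v) = star (J *ᵥ ψ) ⬝ᵥ v := fun v => by
    rw [star_mulVec, (isHermitian_curOpTT' (L := L) 0).eq, ← dotProduct_mulVec]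
  have hovC : star ψ ⬝ᵥ (J *ᵥ ((H * J - J * H) *ᵥ ψ)) =
      star (J *ᵥ ψ) ⬝ᵥ (H *ᵥ (J *ᵥ ψ)) -
        ((fluxEnergyTT' L 0 U δ 0 : ℝ) : ℂ) * (star (J *ᵥ ψ) ⬝ᵥ (J *ᵥ ψ)) := by
    rw [sub_mulVec, ← mulVec_mulVec, ← mulVec_mulVec, hE, mulVec_smul, mulVec_sub, mulVec_smul,
      dotProduct_sub, dotProduct_smul, hJv (H *ᵥ (J *ᵥ ψ)), hJv (J *ᵥ ψ), smul_eq_mul]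
  have hov : (star ψ ⬝ᵥ (J *ᵥ ((H * J - J * H) *ᵥ ψ))).re =
      (star (J *ᵥ ψ) ⬝ᵥ (H *ᵥ (J *ᵥ ψ))).re -
        fluxEnergyTT' L 0 U δ 0 * (star (J *ᵥ ψ) ⬝ᵥ (J *ᵥ ψ)).re := by
    rw [hovC]
    simp only [Complex.sub_re, Complex.mul_re, Complex.ofReal_re, Complex.ofReal_im, zero_mul, sub_zero]
  rw [hov] at h
  simpa only [hHdef, hJdef, hubbardTorusTT'_zero, fluxEnergyTT'_tPrime_zero] using h

end Finite

/-! ### The generic adapter: finite-volume ceiling + torus limit + certificate ⇒ thermodynamic-limit row -/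

/-- **Generic row adapter.** Let `δ ≥ −1` and let `Φ L ψ ∈ ℝ` be a per-side functional of unit sector
ground states with (i) `ρ_s ≤ Φ L ψ` for every unit `(rectN (1−δ) L, 0)`-sector ground state `ψ` of
`hubbardTorus 2 L 1 U` at every even side `L ≥ L₀`, `L ≥ 3`; (ii) along every torus-limit sequence of such
ground states (sides `Ls j → ∞`), `Φ (Ls j) (ψ (Ls j)) → Φ∞ ω`; (iii) `Φ∞ ω ≤ q` for every torus limit `ω`
of such a sequence (the certificate). Then `ρ_s ≤ q`. Proof: unit sector ground states exist at every
side; along the even sides a subsequence has a torus limit (weak-⋆ compactness,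
`InfVolFermionState.exists_isTorusLimitOf_subseq`); pass to the limit in (i) with (ii) and apply (iii).
[cite: BratteliRobinsonI1987, §4.3.1] -/
theorem fluxStiffness_le_of_torusLimit_functional_row {U δ ρs q : ℝ} (hδ : -1 ≤ δ) {L₀ : ℕ}
    (Φ : ∀ L : ℕ, Fock (Orb (FermionTorus 2 L)) → ℝ) (Φinf : InfVolFermionState 2 → ℝ)
    (hfin : ∀ (L : ℕ) [NeZero L], L₀ ≤ L → 3 ≤ L → Even L →
      ∀ ψ : Fock (Orb (FermionTorus 2 L)),
        IsGroundStateInSector (hubbardTorus 2 L 1 U) (rectN (1 - δ) L) 0 ψ → star ψ ⬝ᵥ ψ = 1 →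
          ρs ≤ Φ L ψ)
    (hconv : ∀ (ω : InfVolFermionState 2) (Ls : ℕ → ℕ) (ψ : ∀ L, Fock (Orb (FermionTorus 2 L))),
      Tendsto Ls atTop atTop →
      (∀ j, IsGroundStateInSector (hubbardTorus 2 (Ls j) 1 U) (rectN (1 - δ) (Ls j)) 0 (ψ (Ls j))) →
      (∀ j, star (ψ (Ls j)) ⬝ᵥ ψ (Ls j) = 1) → ω.IsTorusLimitOf ψ Ls →
        Tendsto (fun j => Φ (Ls j) (ψ (Ls j))) atTop (𝓝 (Φinf ω)))
    (hrow : ∀ (ω : InfVolFermionState 2) (Ls : ℕ → ℕ) (ψ : ∀ L, Fock (Orb (FermionTorus 2 L))),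
      Tendsto Ls atTop atTop →
      (∀ j, IsGroundStateInSector (hubbardTorus 2 (Ls j) 1 U) (rectN (1 - δ) (Ls j)) 0 (ψ (Ls j))) →
      (∀ j, star (ψ (Ls j)) ⬝ᵥ ψ (Ls j) = 1) → ω.IsTorusLimitOf ψ Ls → Φinf ω ≤ q) :
    ρs ≤ q := by
  have hn2 : 1 - δ ≤ 2 := by linarith
  -- a unit sector ground state at every side
  let ψ : ∀ L, Fock (Orb (FermionTorus 2 L)) := fun L =>
    Classical.choose (InfVolFermionState.exists_unit_isGroundStateInSector_rectN 1 U hn2 L)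
  have hψ1 : ∀ L, star (ψ L) ⬝ᵥ ψ L = 1 := fun L =>
    (Classical.choose_spec (InfVolFermionState.exists_unit_isGroundStateInSector_rectN 1 U hn2 L)).1
  have hψgs : ∀ L, IsGroundStateInSector (hubbardTorus 2 L 1 U) (rectN (1 - δ) L) 0 (ψ L) := fun L =>
    (Classical.choose_spec (InfVolFermionState.exists_unit_isGroundStateInSector_rectN 1 U hn2 L)).2
  -- the even sides `2(j+1) → ∞`
  let Ls : ℕ → ℕ := fun j => 2 * (j + 1)
  have hLs : Tendsto Ls atTop atTop :=
    tendsto_atTop_mono (fun j : ℕ => (by omega : j ≤ 2 * (j + 1))) tendsto_id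
  obtain ⟨φ, hφ, ω, hω⟩ :=
    InfVolFermionState.exists_isTorusLimitOf_subseq ψ hLs (fun j => hψ1 (Ls j))
  have hLs' : Tendsto (Ls ∘ φ) atTop atTop := hLs.comp hφ.tendsto_atTop
  -- eventually along the subsequence: `ρ_s ≤ Φ`
  have hev : ∀ᶠ j in atTop, ρs ≤ Φ ((Ls ∘ φ) j) (ψ ((Ls ∘ φ) j)) := by
    filter_upwards [hLs'.eventually_ge_atTop (max L₀ 3)] with j hj
    have hL3 : 3 ≤ (Ls ∘ φ) j := le_trans (le_max_right _ _) hj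
    have hL0 : L₀ ≤ (Ls ∘ φ) j := le_trans (le_max_left _ _) hj
    haveI : NeZero ((Ls ∘ φ) j) := ⟨by omega⟩
    exact hfin ((Ls ∘ φ) j) hL0 hL3 (even_two_mul _) (ψ _) (hψgs _) (hψ1 _)
  have hlim := hconv ω (Ls ∘ φ) ψ hLs' (fun j => hψgs _) (fun j => hψ1 _) hω
  have hle : ρs ≤ Φinf ω := ge_of_tendsto hlim hev
  exact hle.trans (hrow ω (Ls ∘ φ) ψ hLs' (fun j => hψgs _) (fun j => hψ1 _) hω)

/-! ### The `R-K3-TL` adapter -/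

/-- The per-side odd-moment functional of the row `R-K3-TL` at fixed `λ` (square torus, `t = 1`, `t' = 0`):
`Φ_λ(L, ψ) = (½Re⟨ψ,𝒦ψ⟩ + 2λ m₁(ψ) + λ² m₃(ψ)) / L²` with `𝒦 = kinOpTT' L 0`, `𝒥 = curOpTT' L 0`,
`m₁ = Re⟨𝒥ψ,H𝒥ψ⟩ − E₀‖𝒥ψ‖²`, `B = H𝒥 − 𝒥H`, `m₃ = Re⟨Bψ,HBψ⟩ − E₀‖Bψ‖²`, `H = hubbardTorus 2 L 1 U`,
`E₀ = fluxEnergy L U δ 0`. [cite: Lipparini2008, eq. (8.30)] -/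
def oddMomentFunctional (U δ lam : ℝ) (L : ℕ) (ψ : Fock (Orb (FermionTorus 2 L))) : ℝ :=
  if hL : L = 0 then 0 else
    haveI : NeZero L := ⟨hL⟩
    ((star ψ ⬝ᵥ (kinOpTT' L 0 *ᵥ ψ)).re / 2 +
        2 * lam * ((star (curOpTT' L 0 *ᵥ ψ) ⬝ᵥ (hubbardTorus 2 L 1 U *ᵥ (curOpTT' L 0 *ᵥ ψ))).re -
          fluxEnergy L U δ 0 * (star (curOpTT' L 0 *ᵥ ψ) ⬝ᵥ (curOpTT' L 0 *ᵥ ψ)).re) +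
        lam ^ 2 * ((star ((hubbardTorus 2 L 1 U * curOpTT' L 0 - curOpTT' L 0 * hubbardTorus 2 L 1 U) *ᵥ ψ) ⬝ᵥ
            (hubbardTorus 2 L 1 U *ᵥ
              ((hubbardTorus 2 L 1 U * curOpTT' L 0 - curOpTT' L 0 * hubbardTorus 2 L 1 U) *ᵥ ψ))).re -
          fluxEnergy L U δ 0 *
            (star ((hubbardTorus 2 L 1 U * curOpTT' L 0 - curOpTT' L 0 * hubbardTorus 2 L 1 U) *ᵥ ψ) ⬝ᵥ
              ((hubbardTorus 2 L 1 U * curOpTT' L 0 - curOpTT' L 0 * hubbardTorus 2 L 1 U) *ᵥ ψ)).re)) /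
      (L : ℝ) ^ 2

/-- At a side `L ≠ 0` the functional is the displayed quotient (the `L = 0` junk value is `0`).
[cite: Lipparini2008, eq. (8.30)] -/
theorem oddMomentFunctional_eq (U δ lam : ℝ) (L : ℕ) [NeZero L] (ψ : Fock (Orb (FermionTorus 2 L))) :
    oddMomentFunctional U δ lam L ψ =
      ((star ψ ⬝ᵥ (kinOpTT' L 0 *ᵥ ψ)).re / 2 +
        2 * lam * ((star (curOpTT' L 0 *ᵥ ψ) ⬝ᵥ (hubbardTorus 2 L 1 U *ᵥ (curOpTT' L 0 *ᵥ ψ))).re -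
          fluxEnergy L U δ 0 * (star (curOpTT' L 0 *ᵥ ψ) ⬝ᵥ (curOpTT' L 0 *ᵥ ψ)).re) +
        lam ^ 2 * ((star ((hubbardTorus 2 L 1 U * curOpTT' L 0 - curOpTT' L 0 * hubbardTorus 2 L 1 U) *ᵥ ψ) ⬝ᵥ
            (hubbardTorus 2 L 1 U *ᵥ
              ((hubbardTorus 2 L 1 U * curOpTT' L 0 - curOpTT' L 0 * hubbardTorus 2 L 1 U) *ᵥ ψ))).re -
          fluxEnergy L U δ 0 *
            (star ((hubbardTorus 2 L 1 U * curOpTT' L 0 - curOpTT' L 0 * hubbardTorus 2 L 1 U) *ᵥ ψ) ⬝ᵥ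
              ((hubbardTorus 2 L 1 U * curOpTT' L 0 - curOpTT' L 0 * hubbardTorus 2 L 1 U) *ᵥ ψ)).re)) /
      (L : ℝ) ^ 2 := by
  rw [oddMomentFunctional, dif_neg (NeZero.ne L)]

/-- **`R-K3-TL` row adapter: a certified thermodynamic-limit bound on the fixed-`λ` odd-moment
functional is a certified stiffness CEILING.** Let `δ ≥ −1`, `λ ∈ ℝ`, and let `ρ_s, θ₀ > 0` be a
uniform flux stiffness of the zero-flux `(N_L, S^z = 0)` sectors of `hubbardTorus 2 L 1 U` along all even
`L ≥ L₀`. Suppose (IDENTIFICATION) that along every torus-limit sequence of unit sector ground states the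
per-site functional `oddMomentFunctional U δ λ` converges to `F ω` for a given functional `F` of the limit
state (for the cell's word densities: `F ω = ½ω(kx) + 2λU·ω(d1U) + λ²(U²ω(m3T) + U³ω(m3U))` — the
expansion of `½𝒦`, `½[𝒥,[H,𝒥]]`, `−½[B,[H,B]]` into translation sums of local words and weak-⋆
convergence, checked outside the kernel), and (CERTIFICATE) that `F ω ≤ q` for every such torus limit
`ω`. Then `ρ_s ≤ q` (tree units). The finite-volume input is `fluxStiffness_mul_sq_le_kinetic_add_oddMoments`;
with `λ = 0` and `F = −k(ω)/4` this is the kinetic adapter of the companion file.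
[cite: ScalapinoWhiteZhang1993, §II] -/
theorem fluxStiffness_le_of_torusLimit_oddMoment_row {U δ ρs θ₀ q : ℝ} (lam : ℝ) (hδ : -1 ≤ δ)
    (hθ₀ : 0 < θ₀) {L₀ : ℕ}
    (hst : ∀ (L : ℕ) [NeZero L], L₀ ≤ L → Even L →
      ∀ θ : ℝ, |θ| ≤ θ₀ → ρs * θ ^ 2 ≤ fluxEnergy L U δ θ - fluxEnergy L U δ 0)
    (F : InfVolFermionState 2 → ℝ)
    (hId : ∀ (ω : InfVolFermionState 2) (Ls : ℕ → ℕ) (ψ : ∀ L, Fock (Orb (FermionTorus 2 L))),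
      Tendsto Ls atTop atTop →
      (∀ j, IsGroundStateInSector (hubbardTorus 2 (Ls j) 1 U) (rectN (1 - δ) (Ls j)) 0 (ψ (Ls j))) →
      (∀ j, star (ψ (Ls j)) ⬝ᵥ ψ (Ls j) = 1) → ω.IsTorusLimitOf ψ Ls →
        Tendsto (fun j => oddMomentFunctional U δ lam (Ls j) (ψ (Ls j))) atTop (𝓝 (F ω)))
    (hrow : ∀ (ω : InfVolFermionState 2) (Ls : ℕ → ℕ) (ψ : ∀ L, Fock (Orb (FermionTorus 2 L))),
      Tendsto Ls atTop atTop →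
      (∀ j, IsGroundStateInSector (hubbardTorus 2 (Ls j) 1 U) (rectN (1 - δ) (Ls j)) 0 (ψ (Ls j))) →
      (∀ j, star (ψ (Ls j)) ⬝ᵥ ψ (Ls j) = 1) → ω.IsTorusLimitOf ψ Ls → F ω ≤ q) :
    ρs ≤ q := by
  refine fluxStiffness_le_of_torusLimit_functional_row hδ (L₀ := L₀) (oddMomentFunctional U δ lam) F
    ?_ hId hrow
  intro L _ hL0 hL3 hEven ψ hgs h1
  have hfin := fluxStiffness_mul_sq_le_kinetic_add_oddMoments hL3 hθ₀ (hst L hL0 hEven) hgs h1 lam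
  have hLpos : (0 : ℝ) < (L : ℝ) ^ 2 := by
    have : (0 : ℝ) < (L : ℝ) := Nat.cast_pos.2 (NeZero.pos L)
    positivity
  rw [oddMomentFunctional_eq, le_div_iff₀ hLpos]
  exact hfin

end Summit.Ventures.CertifiedManyBodySolver.Observables
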